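import Mathlib.Geometry.Manifold.MFDeriv.SpecificFunctions
import Mathlib.Analysis.Complex.Basic
import HarnessLib

/-!
# The tangent representation at a common fixed point: differentials as endomorphisms of the model space

Layer `Literature/Geometry/Kaehler` (the tree's home for complex-manifold notions).  Theorems only (no
definition, no named fact).  For a complex manifold `M` charted on the normed space `E` (model
`𝓘(ℂ, E)`; Mathlib's tangent spaces `TangentSpace 𝓘(ℂ, E) x` are `E` by definition) we read the
differential `mfderiv 𝓘(ℂ, E) 𝓘(ℂ, E) f x` of a self-map as the linear endomorphism
`@id (E →ₗ[ℂ] E) (ContinuousLinearMap.toLinearMap (mfderiv …))` of `E` — the `id` pins the type, so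
that products, `1` and kernels of endomorphisms (`Module.End`) are available without coercion
failures — and record the calculus of the TANGENT REPRESENTATION at a common fixed point `a`
(H. Cartan 1957, §4: "soit `s'` la transformation linéaire tangente à `s`"; Milne, *Algebraic Groups*
13.a): `d(id)_a = 1` (`mfderivEnd_id`) and the chain rule `d(g ∘ f)_a = dg_a ∘ df_a` when `f a = a`
(`mfderivEnd_comp_of_apply_eq`), i.e. `s ↦ ds_a` is a homomorphism on any group of differentiable
maps fixing `a`.  Consumer: the discharge of
`GroupActions.Milne2017_fixedComponent_dim_eq_finrank_tangentFixed`
(`AlgebraicGeometry/GroupActions/FixedLocusTangentDimensionHolds`).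

## References

* [Cartan1957QuotientAnalytique] H. Cartan, *Quotient d'un espace analytique par un groupe
  d'automorphismes*, Princeton Math. Ser. 12 (1957), §4.
* [Milne2017] J. S. Milne, *Algebraic Groups*, CUP 2017, Ch. 13 §a.
-/

noncomputable section

open scoped Manifold ContDiff Topology
open Function Set

namespace Literature.Geometry.Kaehler


/-! ### Differentials at a fixed point as endomorphisms of the model space -/

section ChainRule

variable {E : Type*} [NormedAddCommGroup E] [NormedSpace ℂ E]
  {M : Type*} [TopologicalSpace M] [ChartedSpace E M]

/-! The tangent spaces of a manifold modelled on `𝓘(ℂ, E)` are `E` by definition; we read the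
differential `mfderiv 𝓘(ℂ, E) 𝓘(ℂ, E) f x` as the linear endomorphism
`@id (E →ₗ[ℂ] E) (ContinuousLinearMap.toLinearMap (mfderiv …))` of `E` (the `id` pins the type, so
that products, `1` and kernels of endomorphisms are available), and record the calculus we need. -/

/-- Transport of `df_x` along an equality of maps (the map occurs in the type of `mfderiv`, so this
is a lemma proved by substitution rather than a rewrite). [cite: Cartan1957QuotientAnalytique, §4 (proof of Théorème 4: the tangent linear transformation s′ of s)] -/
theorem mfderivEnd_congr_fun {f g : M → M} (hfg : f = g) (x : M) :
    @id (E →ₗ[ℂ] E) (ContinuousLinearMap.toLinearMap (mfderiv 𝓘(ℂ, E) 𝓘(ℂ, E) f x)) =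
      @id (E →ₗ[ℂ] E) (ContinuousLinearMap.toLinearMap (mfderiv 𝓘(ℂ, E) 𝓘(ℂ, E) g x)) := by
  subst hfg
  rfl

/-- Transport of a value `dg_x w` along an equality of base points. [cite: Cartan1957QuotientAnalytique, §4 (proof of Théorème 4: the tangent linear transformation s′ of s)] -/
theorem mfderiv_apply_congr_point {g : M → M} {x y : M} (hxy : x = y) (w : E) :
    (mfderiv 𝓘(ℂ, E) 𝓘(ℂ, E) g x) w = (mfderiv 𝓘(ℂ, E) 𝓘(ℂ, E) g y) w := by
  subst hxy
  rfl

/-- `d(id)_x = 1`: the tangent representation sends the identity to `1`. [cite: Cartan1957QuotientAnalytique, §4 (proof of Théorème 4: s ↦ s′ is a homomorphism)] -/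
theorem mfderivEnd_id (x : M) :
    @id (E →ₗ[ℂ] E) (ContinuousLinearMap.toLinearMap
      (mfderiv 𝓘(ℂ, E) 𝓘(ℂ, E) (id : M → M) x)) = 1 := by
  apply LinearMap.ext
  intro v
  show (mfderiv 𝓘(ℂ, E) 𝓘(ℂ, E) (id : M → M) x) v = v
  rw [mfderiv_id]
  rfl

/-- **Chain rule at a common fixed point**, as endomorphisms of the model space:
`d(g ∘ f)_a = dg_a ∘ df_a` when `f a = a` (Mathlib's `mfderiv_comp_apply`, with the base point of
`dg` moved along `f a = a`) — the tangent representation at a common fixed point is multiplicative.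
[cite: Cartan1957QuotientAnalytique, §4 (proof of Théorème 4: s ↦ s′ is a homomorphism, σ s = s′ σ)] -/
theorem mfderivEnd_comp_of_apply_eq {f g : M → M} {a : M} (hfa : f a = a)
    (hg : MDifferentiableAt 𝓘(ℂ, E) 𝓘(ℂ, E) g a) (hf : MDifferentiableAt 𝓘(ℂ, E) 𝓘(ℂ, E) f a) :
    @id (E →ₗ[ℂ] E) (ContinuousLinearMap.toLinearMap (mfderiv 𝓘(ℂ, E) 𝓘(ℂ, E) (g ∘ f) a)) =
      @id (E →ₗ[ℂ] E) (ContinuousLinearMap.toLinearMap (mfderiv 𝓘(ℂ, E) 𝓘(ℂ, E) g a)) *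
        @id (E →ₗ[ℂ] E) (ContinuousLinearMap.toLinearMap (mfderiv 𝓘(ℂ, E) 𝓘(ℂ, E) f a)) := by
  have hg' : MDifferentiableAt 𝓘(ℂ, E) 𝓘(ℂ, E) g (f a) := by rw [hfa]; exact hg
  apply LinearMap.ext
  intro v
  exact (mfderiv_comp_apply (hg := hg') (hf := hf) (v := v)).trans (mfderiv_apply_congr_point hfa _)

end ChainRule

end Literature.Geometry.Kaehler

end
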